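import Summits.ABC.IUTFork.Charitable.Thm311D2
import HarnessLib

/-!
# [IUTchIII] Theorem 3.11 — team D2's PRINT-SENSE companion `Thm311PrintSense_2` (Rmk. 3.11.4 fixes the sense of (iii) (c)/(d)'s final sentences)

Record-only file (D-0012) of the abc-iut cell, seat abc-iut-D2-typ (branch D, team D2 typer; rung LADDER-ABC:A2.D), companion of
`Charitable/Thm311D2.lean` (p428473/p429714: the CHARITABLE typing `Thm311Charitable_2`). TAKES NO SIDE on [IUTchIII] Cor. 3.12 or on
any author; NO `Prop` FACT (reading predicates only, never asserted); typed ≠ proved. Written AFTER «D: BLIND LIFTED» (06:41Z) and after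
team D1's CONCORDANCE-D1.md §3 pointed this seat to Remark 3.11.4 (credited; post-blind). Source: S. Mochizuki, *Inter-universal
Teichmüller theory III*, kurims manuscript (May 2020) = `paper:url-4b091feeb646`, Rmk. 3.11.4 pp. 171–173 (render
`HOME/lit/renders/IUTchIII-kurims-url-4b091feeb646/p0171–p0173.txt`), read on the render by this seat. [claim: Mochizuki2012, status: disputed]
-/

/-! ## The PRINT-FIXED sense of the load-bearing sentence (Rmk. 3.11.4)

The load-bearing sentence p. 158 l. 6–15 ends "[cf. also the discussion of Remark 3.11.4 below]". Remark 3.11.4 (pp. 171–173; outside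
the pp. 153–167 read for the typing `Thm311Charitable_2` of `Charitable/Thm311D2.lean`, read by this seat only after team D1's CONCORDANCE-D1.md §3 pointed to it — post-blind,
credited) FIXES the sense of that "compatibility": (i) p. 171 l. 13–23 "consideration of the log-Kummer correspondence in the context of
the compatibility discussed in the final portion of Theorem 3.11, (iii), (c), (d), amounts precisely to forgetting the labels of the
various Frobenius-like '•'s …, i.e., to identifying data associated to these Frobenius-like '•'s with the corresponding data associated
to the étale-like '◦' … this data of Theorem 3.11, (ii), (b), (c), may only be considered up to multiplication by roots of unity";
p. 172 l. 34–41 "the various indeterminacies that, a priori, might arise … are in fact 'invisible', i.e., they have no substantive effect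
on the objects under consideration …. This is precisely the sense in which the 'compatibility' stated in the final portion of Theorem
3.11, (iii), (c), (d), is to be understood."; (iii) p. 173 l. 15–24 "the indeterminacies (Ind1), (Ind2) …, which act, essentially, on
the data of Theorem 3.11, (ii), (a), have no effect on the geometric containers … that underlie … the data considered in Theorem 3.11,
(ii), (b), (c)". Typed below as `III_c_InvisibleRootsOfUnity` ((i), literal) and the stronger named variant `III_c_IndNoEffect` ((iii)) (Θ-side or number-field-side ONLY: no relation to the codomain strip's q-datum `qK`),
and assembled with the unchanged Parts (i), (ii), (iii) (a)(b)(d) + the gloss into `Thm311PrintSense_2` — the typing of Theorem 3.11 in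
the sense print itself fixes for T20. Bookkeeping: `Thm311Charitable_2 = (Thm311PrintSense_2 minus III_c_InvisibleRootsOfUnity) + III_c_KummerLinkSquare`
(`charitable_2_of_printSense_of_square`), so branch D2's dichotomy is ONE corner: the print-sense typing does not mention `qK` at all
(hence cannot yield `S`; team D2-cx's model of record is expected to satisfy it with `¬S`), the charitable typing adds the square and
yields `S` (p428699). Nothing asserted; typed ≠ proved. -/

noncomputable section

namespace Summit.ABC.IUTFork.Charitable.D2

open Thm311 Cor312 Cor312Vol

variable {T : ThetaIndex} (S : LatticeSituation T)

/-- **(iii) (c)/(d), final sentences, IN THE SENSE FIXED BY Rmk. 3.11.4 (i)** (p. 171 l. 13–23, p. 172 l. 34–41, quoted in the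
module docstring): "forgetting the labels" = the identification of each column's Frobenius-like (ii) (b), (c) data with its étale-like
data (already `II_b_SplittingKummer`, `II_c_NumberFieldKummer`), and INVISIBILITY of the a-priori indeterminacies on that data: "this
data of Theorem 3.11, (ii), (b), (c), may only be considered up to multiplication by roots of unity … the theory … [is] invariant with
respect to such indeterminacies [i.e., multiplication of the theta values by 2l-th roots of unity]", for the number fields "the entire
set … is stabilized by multiplication by roots of unity", the cyclotomic-rigidity indeterminacies being "± 1 on copies of 𝔽×_mod" resp.
"trivial" (p. 172 l. 1–14). PLAIN reading in the carriers, where multiplication by roots of unity on the packets is the (Ind2) family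
("Ism", p. 154 l. 55–63): every (Ind2) generator FIXES the étale-like splitting-monoid datum `Ψ` (bad places) and the number-field
copies `Mmod`, at every column. Θ-side or NF-side only; says nothing about `qK`. [claim: Mochizuki2012, status: disputed] -/
@[claim "Mochizuki2012" "disputed"]
def III_c_InvisibleRootsOfUnity : Prop :=
  (∀ (n : ℤ) (Φ : S.L.PacketAut), Φ ∈ S.L.Ind2Family →
      ∀ (v : T.V) (hv : v ∈ T.Vbad), S.L.starAut Φ v '' (S.D n).Ψ v hv = (S.D n).Ψ v hv) ∧
  (∀ (n : ℤ) (Φ : S.L.PacketAut), Φ ∈ S.L.Ind2Family →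
      ∀ j : T.LabelStar, S.L.globalAut Φ j.1 '' (S.D n).Mmod j = (S.D n).Mmod j)

/-- **Rmk. 3.11.4 (iii), read STRONGLY** (p. 173 l. 15–24: "the multiradiality and radial/coric decoupling … [cf. also Theorem 3.11,
(iii), (c), (d)] may be understood as asserting precisely that the indeterminacies (Ind1), (Ind2) …, which act, essentially, on the
data of Theorem 3.11, (ii), (a), have no effect on the geometric containers … that underlie [i.e., prior to execution of the relevant
evaluation operations] the data considered in Theorem 3.11, (ii), (b), (c)"). WEAKEST: no effect on the containers BEFORE evaluation
(not expressible in the carriers, which hold evaluated data only). STRONGEST (typed here as a NAMED variant, NOT a conjunct of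
`Thm311PrintSense_2`; flagged for the referee): every (Ind1)/(Ind2) generator fixes the evaluated data `Ψ` and `Mmod`. Under it the orbit
`^{n,∘}ℜ^LGP` has ONE splitting-monoid datum (`psi_eq_of_mem_RLGP_of_indNoEffect`). [claim: Mochizuki2012, status: disputed] -/
@[claim "Mochizuki2012" "disputed"]
def III_c_IndNoEffect : Prop :=
  (∀ (n : ℤ) (Φ : S.L.PacketAut), Φ ∈ S.L.Ind1Family ∪ S.L.Ind2Family →
      ∀ (v : T.V) (hv : v ∈ T.Vbad), S.L.starAut Φ v '' (S.D n).Ψ v hv = (S.D n).Ψ v hv) ∧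
  (∀ (n : ℤ) (Φ : S.L.PacketAut), Φ ∈ S.L.Ind1Family ∪ S.L.Ind2Family →
      ∀ j : T.LabelStar, S.L.globalAut Φ j.1 '' (S.D n).Mmod j = (S.D n).Mmod j)

/-- **`Thm311PrintSense_2` — Theorem 3.11 (i) ∧ (ii) ∧ (iii) with (iii) (c)/(d)'s final sentences in the sense PRINT FIXES (Rmk.
3.11.4 (i))**: Parts (i), (ii) of `Thm311D2.lean`; (iii) = unit portion ∧ the gloss ∧ invisibility of the root-of-unity
indeterminacies ∧ number-field link. It has NO `qK` binder — the print-fixed sense relates no codomain q-datum to the Θ-data —, so no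
derivation of `S` can consume it; the expected (b)-line for it is the model of record (team D2-cx). A HYPOTHESIS, never asserted.
[claim: Mochizuki2012, status: disputed] -/
@[claim "Mochizuki2012" "disputed"]
def Thm311PrintSense_2 : Prop :=
  PartI S ∧ PartII S ∧
    (III_ab_UnitPortionLink S ∧ III_c_Stabilized S ∧ III_c_InvisibleRootsOfUnity S ∧ III_d_NumberFieldLink S)

/-- Bookkeeping: the charitable typing is the print-sense typing (its invisibility conjunct unused) PLUS the one corner
`III_c_KummerLinkSquare`. [folklore] -/
theorem charitable_2_of_printSense_of_square {n : ℤ} {qK : ∀ v : T.V, v ∈ T.Vbad → Set (S.L.StarPacket v)}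
    (h : Thm311PrintSense_2 S) (hsq : III_c_KummerLinkSquare S n qK) : Thm311Charitable_2 S n qK :=
  ⟨h.1, h.2.1, ⟨h.2.2.1, h.2.2.2.1, hsq, h.2.2.2.2.2⟩⟩

/-- … and conversely the charitable typing together with invisibility gives the print-sense typing (the square is simply dropped).
[folklore] -/
theorem printSense_of_charitable_2 {n : ℤ} {qK : ∀ v : T.V, v ∈ T.Vbad → Set (S.L.StarPacket v)}
    (h : Thm311Charitable_2 S n qK) (hinv : III_c_InvisibleRootsOfUnity S) : Thm311PrintSense_2 S :=
  ⟨h.1, h.2.1, ⟨h.2.2.1, h.2.2.2.1, hinv, h.2.2.2.2.2⟩⟩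

/-- The strong (iii)-reading implies the (i)-reading. [folklore] -/
theorem invisibleRootsOfUnity_of_indNoEffect (h : III_c_IndNoEffect S) : III_c_InvisibleRootsOfUnity S :=
  ⟨fun n Φ hΦ => h.1 n Φ (Or.inr hΦ), fun n Φ hΦ => h.2 n Φ (Or.inr hΦ)⟩

/-- Under the STRONG (iii)-reading the orbit of the Θ-datum collapses: every member of `^{n,∘}ℜ^LGP` has the SAME splitting-monoid
datum as the column's étale-like data — so "possible images of the Θ-pilot datum up to (Ind1), (Ind2)" is then ONE datum, and `S`
would require `ρ qK = ρ Ψ` on the nose (cf. `Cor312Vol.PinnedHonest`: refuted by honest volumes under the pins). [folklore] -/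
theorem psi_eq_of_mem_RLGP_of_indNoEffect (hinv : III_c_IndNoEffect S) (n : ℤ) {D' : MRData S.L} (hD' : D' ∈ S.RLGP n) :
    D'.Ψ = (S.D n).Ψ := by
  have key : ∀ x y : MRData S.L, Relation.EqvGen MRData.IndMoves x y →
      (x.Ψ = (S.D n).Ψ ↔ y.Ψ = (S.D n).Ψ) := by
    intro x y h
    induction h with
    | rel x y hxy =>
      obtain ⟨Φ, hΦ, rfl⟩ := hxy
      have hfix : ∀ (v : T.V) (hv : v ∈ T.Vbad), S.L.starAut Φ v '' (S.D n).Ψ v hv = (S.D n).Ψ v hv :=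
        hinv.1 n Φ hΦ
      constructor
      · intro hx
        funext v hv
        change S.L.starAut Φ v '' x.Ψ v hv = (S.D n).Ψ v hv
        rw [hx, hfix v hv]
      · intro hy
        funext v hv
        have h1 : S.L.starAut Φ v '' x.Ψ v hv = (S.D n).Ψ v hv := congrFun (congrFun hy v) hv
        rw [← hfix v hv] at h1
        exact (LinearEquiv.injective _).image_injective h1
    | refl x => exact Iff.rfl
    | symm x y _ ih => exact ih.symm
    | trans x y z _ _ ih1 ih2 => exact ih1.trans ih2
  have h' : Relation.EqvGen MRData.IndMoves (S.D n) D' := hD'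
  exact (key _ _ h').1 rfl

end Summit.ABC.IUTFork.Charitable.D2

end
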